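import Summits.QuantumFields.YangMills.Theorems.BalabanUVNodesN15KingModelProps37To39AtZeroField
import Summits.QuantumFields.YangMills.Theorems.BalabanUVNodesN15KingModelCurvedHTorusProp38ByName
import HarnessLib

/-!
# BalabanUVNodes ∕ N15 — THE KING-MODEL RUNG, CURVED EDITION (PART Ω₁): KING 1986 §3.3 PROPOSITIONS 3.7, 3.8 AND 3.9 (and §2 (2.17)) **AT `A = 0`,
# BY NAME, FOR ONE AND THE SAME TWO-SPACING DATUM** — the typer's `SlicePropagator.TwoSpacing` record with EVERY field live: the slices `G^η_{(j)}`,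
# `G^{η′}_{(j)}` of the two runs (this lineage's `kingSlicesTwoSpacing`, parts Ρ∕Χ) AND the external-line kernels `a_kG^η_kQ^*_k = ℋ_k`,
# `a_{k+n}G^{η′}_{k+n}Q^*_{k+n} = ℋ_{k+n}` with their gradients (dag-n15-d's `kingTwoSpacingH`, parts 51–54) on the one carrier
# (Track A, DAG node N15 = NE2; FAN-OUT v1.1 §N15 s3 «KING-MODEL RUNG»)

HONEST FRAMING.  Count-neutral kernel bookkeeping (cell `pub-ymgap`, seat `pub-ymgap-dag-n15-e` g23; `--supports stmt-QuantumFields-27366 --as helper`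
= K3⁸ `SpineGivenEndpointR13SepCoPHV`).  TEMPLATE LITERATURE, `A = 0`: C. King's scalar U(1)-Higgs MODEL on finite tori ([King1986] §3.3 Props. 3.7–3.9,
pp. 663–665 — PRINTED and proved there for ONE system of objects at two lattice spacings `η = L^{−k}`, `η′ = L^{−k−n}` with the pairing `x′ ↦ x`); NOT
Bałaban's covariant `G(U)` ∕ `H_k(U)`; NE2⁺ is NOT PRINTED for those and not proved; NOT a node discharge; N15's located burden («non-abelian `G(U)`
dressing of NE2», director-ym №253) untouched; nothing continuum ∕ ℝ⁴ ∕ OS ∕ mass-gap ∕ Clay.  0 `sorry`; ONE plumbing `def` (the joint datum, a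
`with`-update of part Χ-a's record — no new kernel is defined); standard axioms.

WHY THIS FILE.  The typer's record `TwoSpacing d` (`King1986/SlicePropagatorStatements`) carries BOTH Proposition 3.8's external-line kernels
(`K, dK, K′, dK′, IsUnit`) AND Proposition 3.9's slice data (`lo, hi, pt, bd`), because King states (3.71) and (3.73)–(3.75) for the same pair of
lattices, the same pairing and the same unit points.  The tree's two by-name inhabitants at `A = 0` each leave the OTHER half inert: this lineage's
`kingSlicesTwoSpacing` (part Χ-a: `K = K′ = 0`, `IsUnit = True`) carries `Prop39KingOrder` (part Χ-d) and (2.17) (part Χ-e); dag-n15-d's `kingTwoSpacingH`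
(their part 51: slices `G = dG = Gc = 0`) carries `Prop38KingOrder` (their part 54 `N15.KingModel.prop38KingOrder_kingTwoSpacingH`).  Here the two
halves are put on ONE record — `kingTwoSpacingFull L a m² j n` := part Χ-a's datum over the volume `kingVol L j = 2L^{j.m}` with dag-n15-d's five
K-fields written in VERBATIM (their fine run lives on `Tor (fine (L^n·L^K) M)`, ours on `Tor (fine (L^{K+n}) M)`: the carrier equivalence
`King1986.Torus.torCongr` along `L^{K+n} = L^nL^K`, already inside part Χ-a's pairing `kingSlicePt`, does the re-spelling) — and BOTH propositions are
read off BY NAME: `Prop39PrintedAt α (kingTwoSpacingFull …) C δ₀ γ` IS `Prop39PrintedAt α (kingSlicesTwoSpacing …) C δ₀ γ` (`Iff.rfl`: Prop. 3.9 does not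
read the K-fields), and `Prop38PrintedAt α (kingTwoSpacingFull …) C δ₀ γ ↔ Prop38PrintedAt α (kingTwoSpacingH …) C δ₀ γ` (Prop. 3.8 does not read the
slices; the two data agree on sites, unit points, kernels and pairing, and their distances are the same number `|x − y|∕L^K` spelled `tdistT∕(L:ℝ)^K`
here and `holdist (L^K)` = `tdistT∕((L^K : ℕ) : ℝ)` there).  NOTHING of dag-n15-d's is re-proved or restated: their theorem is invoked by name and
transported along the carrier equivalence only.

MAIN RESULTS.  §1 `kingTwoSpacingFull` + readers (the coarse datum IS part Ρ-e's `kingSliceKernels` at `kingVol L j`); §2 `prop39PrintedAt_kingTwoSpacingFull_iff` ∕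
`prop39KingOrder_kingTwoSpacingFull_iff` (`Iff.rfl`); §3 the dictionary with
dag-n15-d's datum (`kingTwoSpacingFull_lodist_eq`, `…_hidist_eq`, `…_pt_eq`) and ★ `prop38PrintedAt_kingTwoSpacingFull_iff`; §4 ★★
`prop38PrintedAt_kingTwoSpacingFull_unif` ∕ `prop39PrintedAt_kingTwoSpacingFull_unif` (for each `0 < α < 1` ONE `(C, δ₀, γ > 0)` for all volumes `j`,
all `n ≥ 1`, all masses `0 < m² ≤ m₀²` — dag-n15-d part 54 ∕ this lineage part Χ-d by name), `prop38KingOrder_kingTwoSpacingFull`,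
`prop39KingOrder_kingTwoSpacingFull`, and ★★★ **`king_props37_38_39_and_217_oneDatum`**: for `T = kingTwoSpacingFull L a m² j n`,
`Prop37KingOrder T.lo ∧ Prop37KingOrder ((k+n)-run) ∧ Prop38KingOrder T ∧ Prop39KingOrder T ∧ (2.17) for both runs` — King's §3.3 two-spacing statements
for ONE system of `A = 0` objects, every conjunct a landed theorem by name; `kingTwoSpacingFull_family_nonempty` (non-vacuity); §5 ★★
`kingTwoSpacingFull_K_eq_aK_sum_slices` ∕ `kingTwoSpacingFull_K'_eq_aK_sum_slices`: the record's external-line kernels ARE King's `a_kG^η_kQ_k^*` ((2.15))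
of the record's OWN slices summed by (2.17) — Proposition 3.8's objects are FUNCTIONS of Proposition 3.9's objects on this record, exactly (via the new
matrix identity `minimiserMat = a • (constrainedProp * Qmatᵀ)` in part J's vocabulary and part Χ-e's transports).

HONEST SCOPE: `A = 0`, periodic b.c. `Ω = T_η`, odd `L ≥ 3`, `a > 0`, `K, n ≥ 1`, Bałaban's volumes `2L^m` (`kingVol`), `0 < m² ≤ m₀²`; the contour sort is
EMPTY BY TYPE (`B = PEmpty`: (3.64)∕(3.74) concern the vector field's slices along contours, absent in the scalar model — said, not hidden); the
family-uniform schemas `Prop37Printed`∕`Prop38Printed`∕`Prop39Printed` (α INSIDE one constant) are NOT claimed (King's order «0 < α < 1, and γ sufficiently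
small»: `γ = γ(α)`); the K-lines are King's (3.71) for the minimiser `ℋ` with the POINT distance (dag-n15-d's reading), the slice lines King's (3.73)∕(3.75)
in continuum units (this lineage's reading) — the two readings share the distance `|x − y|` in unit-lattice coordinates, which is why one record carries both.
WHAT THE CURVED CASE ADDS (one line): the same record for `G_(j)(Ω, A)`, `ℋ_k(Ω, A)` at a regular `A ≠ 0` (Def. 3.2) on `Ω ⊊ T_η` with the contour clauses —
[King1986] §4 proves the η-RATES at `A = 0` only (p. 670: *"free boundary conditions (and A = 0, of course)"*); Bałaban's `G(U)`, `H_k(U)`: not in the model.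
Locators: [King1986] CMP **102** (1986): (2.13)–(2.17) p. 653, (2.20) p. 654, Thm. 3.3 p. 655, (3.62) + Prop. 3.7 (3.63)–(3.65) p. 663, p. 664 (two spacings,
pairing `x′ ↦ x`, unit points `T^{(k)}`) + Prop. 3.8 (3.71) p. 664, Prop. 3.9 (3.73)–(3.75) p. 665, §4 p. 670 («A = 0, of course»), (4.42)–(4.43) p. 675.
-/

noncomputable section

namespace Summit.QuantumFields.YangMills.BalabanUVNodes.N15KingModelRung.Curved

open Real Finset Matrix
open Literature.MathematicalPhysics.QuantumFieldTheory.Balaban1983to89.B5Prop11Plancherel (Tor fine unitVec)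
open Literature.MathematicalPhysics.QuantumFieldTheory.King1986 (aK)
open Literature.MathematicalPhysics.QuantumFieldTheory.King1986.Torus (blockOf tdistT tdistT_nonneg torCongr torCongr_refl tdistT_torCongr
  holdist constrainedProp fineOp Qmat minimiser minimiserMat minimiserMat_apply)
open Literature.MathematicalPhysics.QuantumFieldTheory.King1986.SlicePropagator (SliceKernels TwoSpacing holderDeriv Prop37KingOrder
  Prop38KingOrder Prop39KingOrder Prop38PrintedAt Prop39PrintedAt)
open Summit.QuantumFields.YangMills.BalabanUVNodes.N15KingModelRung (KingVolIndex kingVol kingVol_neZero basePt kingH dkingH)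
open Summit.QuantumFields.YangMills.BalabanUVNodes.N15.KingModel (kingTwoSpacingH prop38KingOrder_kingTwoSpacingH
  slicePropagator_prop38PrintedAt_kingTwoSpacingH_unif)

variable {d : ℕ} (L : ℕ) [NeZero L]

/-! ## §1 The joint two-spacing datum: part Χ-a's slices with dag-n15-d's external-line kernels, on one record -/

/-- **THE FULL TWO-SPACING DATUM OF KING's §3.3 AT `A = 0`** over Bałaban's volume `kingVol L j = 2L^{j.m}` with `K = j.K ≥ 1` coarse scales and `n` extra
scales: part Χ-a's `kingSlicesTwoSpacing L K n j.m (kingVol L j) … a m²` (coarse run on `T_η = Tor (fine (L^K) M)`, fine run on `T_{η′} = Tor (fine (L^{K+n}) M)`,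
slices `G^η_{(j)}`, `G^{η′}_{(j)}` of the two `A = 0` propagators (2.17), King's pairing `x′ ↦ x`, the empty contour sort) WITH Proposition 3.8's fields made
LIVE by dag-n15-d's data VERBATIM: unit points = base points of the unit blocks; `K(x, z) = ℋ_K(x, B(z))` (`kingH` at `N = L^K`), `dK` its forward
η-derivative (`dkingH`); `K′(x′, z) = ℋ_{K+n}(x′, B(z))`, `dK′` — the `(K+n)`-run's minimiser, read through the carrier equivalence
`torCongr : Tor (fine (L^{K+n}) M) ≃ Tor (fine (L^n·L^K) M)` (the spelling `L^{K+n} = L^nL^K`, part Χ-a `carrier_pow_add`).  Plumbing (a `with`-update of a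
landed record; no new kernel). [cite: King1986, (2.13)–(2.17) p.653, p.664 (two spacings, pairing, unit points), Prop. 3.8 (3.71) p.664, Prop. 3.9 (3.73) p.665] -/
def kingTwoSpacingFull (a msq : ℝ) (j : KingVolIndex d) (n : ℕ) : TwoSpacing (d + 1) :=
  haveI := kingVol_neZero L j
  { kingSlicesTwoSpacing L j.K n j.m (kingVol L j) (fun _ => rfl) j.one_le_K a msq with
    IsUnit := fun z => z = basePt (L ^ j.K) (kingVol L j) (blockOf (L ^ j.K) (kingVol L j) z)
    K := fun x z => kingH L (L ^ j.K) (kingVol L j) a msq j.K (blockOf (L ^ j.K) (kingVol L j) z) x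
    dK := fun μ x z => dkingH L (L ^ j.K) (kingVol L j) a msq j.K (blockOf (L ^ j.K) (kingVol L j) z) μ x
    K' := fun x' z => kingH L (L ^ n * L ^ j.K) (kingVol L j) a msq (j.K + n) (blockOf (L ^ j.K) (kingVol L j) z)
      (torCongr (carrier_pow_add L j.K n (kingVol L j)) x')
    dK' := fun μ x' z => dkingH L (L ^ n * L ^ j.K) (kingVol L j) a msq (j.K + n) (blockOf (L ^ j.K) (kingVol L j) z) μ
      (torCongr (carrier_pow_add L j.K n (kingVol L j)) x') }

variable {L} (a msq : ℝ) (j : KingVolIndex d) (n : ℕ)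

/-- Reading: the slice half of the record IS part Χ-a's datum — coarse slices. [folklore] -/
theorem kingTwoSpacingFull_lo :
    haveI := kingVol_neZero L j; (kingTwoSpacingFull L a msq j n).lo = (kingSlicesTwoSpacing L j.K n j.m (kingVol L j) (fun _ => rfl) j.one_le_K a msq).lo := rfl

/-- Reading: fine slices. [folklore] -/
theorem kingTwoSpacingFull_hi :
    haveI := kingVol_neZero L j; (kingTwoSpacingFull L a msq j n).hi = (kingSlicesTwoSpacing L j.K n j.m (kingVol L j) (fun _ => rfl) j.one_le_K a msq).hi := rfl

/-- Reading: the coarse datum is part Ρ-e's `kingSliceKernels` at the volume `kingVol L j`. [folklore] -/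
theorem kingTwoSpacingFull_lo_eq_kingSliceKernels :
    haveI := kingVol_neZero L j; (kingTwoSpacingFull L a msq j n).lo = kingSliceKernels L j.K j.m (kingVol L j) (fun _ => rfl) j.one_le_K a msq := rfl

/-- Reading: the pairing is part Χ-a's `kingSlicePt` (King's `x_μ = ⌊x′_μ∕L^n⌋`). [cite: King1986, p.664 (pairing)] -/
theorem kingTwoSpacingFull_pt (x' : Tor (fine (L ^ (j.K + n)) (kingVol L j))) :
    (kingTwoSpacingFull L a msq j n).pt x' = kingSlicePt L j.K n (kingVol L j) x' := rfl

/-- Reading: unit points = base points of the unit blocks (dag-n15-d's `IsUnit`). [cite: King1986, p.664 («z ∈ T^{(k)}»)] -/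
theorem kingTwoSpacingFull_isUnit (z : Tor (fine (L ^ j.K) (kingVol L j))) :
    haveI := kingVol_neZero L j; (kingTwoSpacingFull L a msq j n).IsUnit z ↔ z = basePt (L ^ j.K) (kingVol L j) (blockOf (L ^ j.K) (kingVol L j) z) := Iff.rfl

/-- Reading: `K(x, z) = ℋ_K(x, B(z))`. [cite: King1986, (2.15) p.653, Prop. 3.8 p.664] -/
theorem kingTwoSpacingFull_K (x z : Tor (fine (L ^ j.K) (kingVol L j))) :
    haveI := kingVol_neZero L j; (kingTwoSpacingFull L a msq j n).K x z = kingH L (L ^ j.K) (kingVol L j) a msq j.K (blockOf (L ^ j.K) (kingVol L j) z) x := rfl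

/-- Reading: `dK_μ(x, z) = ∂^η_μℋ_K(x, B(z))`. [cite: King1986, Prop. 3.8 p.664] -/
theorem kingTwoSpacingFull_dK (μ : Fin (d + 1)) (x z : Tor (fine (L ^ j.K) (kingVol L j))) :
    haveI := kingVol_neZero L j; (kingTwoSpacingFull L a msq j n).dK μ x z = dkingH L (L ^ j.K) (kingVol L j) a msq j.K (blockOf (L ^ j.K) (kingVol L j) z) μ x := rfl

/-- Reading: `K′(x′, z) = ℋ_{K+n}(x′, B(z))`, the fine point read through the carrier equivalence. [cite: King1986, Prop. 3.8 p.664] -/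
theorem kingTwoSpacingFull_K' (x' : Tor (fine (L ^ (j.K + n)) (kingVol L j))) (z : Tor (fine (L ^ j.K) (kingVol L j))) :
    haveI := kingVol_neZero L j; (kingTwoSpacingFull L a msq j n).K' x' z = kingH L (L ^ n * L ^ j.K) (kingVol L j) a msq (j.K + n) (blockOf (L ^ j.K) (kingVol L j) z)
      (torCongr (carrier_pow_add L j.K n (kingVol L j)) x') := rfl

/-- Reading: `dK′_μ(x′, z) = ∂^{η′}_μℋ_{K+n}(x′, B(z))`. [cite: King1986, Prop. 3.8 p.664] -/
theorem kingTwoSpacingFull_dK' (μ : Fin (d + 1)) (x' : Tor (fine (L ^ (j.K + n)) (kingVol L j))) (z : Tor (fine (L ^ j.K) (kingVol L j))) :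
    haveI := kingVol_neZero L j; (kingTwoSpacingFull L a msq j n).dK' μ x' z = dkingH L (L ^ n * L ^ j.K) (kingVol L j) a msq (j.K + n) (blockOf (L ^ j.K) (kingVol L j) z) μ
      (torCongr (carrier_pow_add L j.K n (kingVol L j)) x') := rfl

/-! ## §2 Propositions 3.7 and 3.9 on the joint record are LITERALLY those of part Χ-a's datum -/

/-- ★ **PROPOSITION 3.9 DOES NOT READ THE EXTERNAL-LINE FIELDS**: at every exponent and every constant triple, the schema's (3.73)–(3.75) for the joint record
IS (3.73)–(3.75) for part Χ-a's datum — definitionally. [cite: King1986, Prop. 3.9 (3.73)–(3.75) p.665] -/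
theorem prop39PrintedAt_kingTwoSpacingFull_iff (α C δ₀ γ : ℝ) :
    haveI := kingVol_neZero L j; Prop39PrintedAt α (kingTwoSpacingFull L a msq j n) C δ₀ γ
      ↔ Prop39PrintedAt α (kingSlicesTwoSpacing L j.K n j.m (kingVol L j) (fun _ => rfl) j.one_le_K a msq) C δ₀ γ :=
  Iff.rfl

/-- Hence `Prop39KingOrder` transfers verbatim. [cite: King1986, Prop. 3.9 (3.73)–(3.75) p.665] -/
theorem prop39KingOrder_kingTwoSpacingFull_iff :
    haveI := kingVol_neZero L j; Prop39KingOrder (kingTwoSpacingFull L a msq j n)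
      ↔ Prop39KingOrder (kingSlicesTwoSpacing L j.K n j.m (kingVol L j) (fun _ => rfl) j.one_le_K a msq) :=
  Iff.rfl

/-! ## §3 The dictionary with dag-n15-d's Proposition-3.8 datum `kingTwoSpacingH L a m² j n` -/

/-- The coarse distances agree: `|x − y|∕L^K` here (`tdistT∕(L:ℝ)^K`) is dag-n15-d's `holdist (L^K)` (`tdistT∕((L^K : ℕ) : ℝ)`) — as functions.
[cite: King1986, (3.62) p.663 (the distance `|x − y|`)] -/
theorem kingTwoSpacingFull_lodist_eq :
    (kingTwoSpacingFull L a msq j n).lo.dist = (kingTwoSpacingH L a msq j n).lo.dist := by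
  haveI := kingVol_neZero L j
  funext x y
  show tdistT (fine (L ^ j.K) (kingVol L j)) x y / (L : ℝ) ^ j.K = tdistT (fine (L ^ j.K) (kingVol L j)) x y / ((L ^ j.K : ℕ) : ℝ)
  rw [Nat.cast_pow]

/-- The fine distances agree through the carrier equivalence: `|x′ − y′|∕L^{K+n} = holdist (L^n·L^K) (τx′) (τy′)` (`tdistT` is preserved by `torCongr`).
[cite: King1986, (3.62) p.663, (2.20) p.654] -/
theorem kingTwoSpacingFull_hidist_eq :
    (kingTwoSpacingFull L a msq j n).hi.dist
      = fun x' y' => (kingTwoSpacingH L a msq j n).hi.dist (torCongr (carrier_pow_add L j.K n (kingVol L j)) x')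
          (torCongr (carrier_pow_add L j.K n (kingVol L j)) y') := by
  haveI := kingVol_neZero L j
  funext x' y'
  show tdistT (fine (L ^ (j.K + n)) (kingVol L j)) x' y' / (L : ℝ) ^ (j.K + n)
    = tdistT (fine (L ^ n * L ^ j.K) (kingVol L j)) (torCongr (carrier_pow_add L j.K n (kingVol L j)) x')
        (torCongr (carrier_pow_add L j.K n (kingVol L j)) y') / ((L ^ n * L ^ j.K : ℕ) : ℝ)
  rw [tdistT_torCongr]
  congr 1
  push_cast
  ring

/-- The pairings agree: `pt x′ = underPtN (τx′)` (part Χ-a's `kingSlicePt` IS dag-n15-d's `underPtN` read through `τ`). [cite: King1986, p.664 (pairing)] -/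
theorem kingTwoSpacingFull_pt_eq (x' : Tor (fine (L ^ (j.K + n)) (kingVol L j))) :
    (kingTwoSpacingFull L a msq j n).pt x' = (kingTwoSpacingH L a msq j n).pt (torCongr (carrier_pow_add L j.K n (kingVol L j)) x') := rfl

/-- The external-line kernels agree (by construction): `K`. [folklore] -/
theorem kingTwoSpacingFull_K_eq (x z : Tor (fine (L ^ j.K) (kingVol L j))) :
    (kingTwoSpacingFull L a msq j n).K x z = (kingTwoSpacingH L a msq j n).K x z := rfl

/-- The external-line kernels agree (by construction): `K′` through `τ`. [folklore] -/
theorem kingTwoSpacingFull_K'_eq (x' : Tor (fine (L ^ (j.K + n)) (kingVol L j))) (z : Tor (fine (L ^ j.K) (kingVol L j))) :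
    (kingTwoSpacingFull L a msq j n).K' x' z
      = (kingTwoSpacingH L a msq j n).K' (torCongr (carrier_pow_add L j.K n (kingVol L j)) x') z := rfl

/-- ★ **PROPOSITION 3.8 DOES NOT READ THE SLICES, AND THE TWO DATA AGREE ON EVERYTHING IT READS**: at every exponent and every constant triple, the schema's
(3.71) for the joint record ⟺ (3.71) for dag-n15-d's datum `kingTwoSpacingH L a m² j n` (same sites, unit points, kernels, pairing, distances; the fine point
re-indexed by the carrier equivalence `τ`). [cite: King1986, Prop. 3.8 (3.71) p.664] -/
theorem prop38PrintedAt_kingTwoSpacingFull_iff (α C δ₀ γ : ℝ) :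
    Prop38PrintedAt α (kingTwoSpacingFull L a msq j n) C δ₀ γ ↔ Prop38PrintedAt α (kingTwoSpacingH L a msq j n) C δ₀ γ := by
  have hsurj := (torCongr (carrier_pow_add L j.K n (kingVol L j))).surjective
  have hlo := kingTwoSpacingFull_lodist_eq (L := L) a msq j n
  have hhi := kingTwoSpacingFull_hidist_eq (L := L) a msq j n
  unfold Prop38PrintedAt
  rw [hlo, hhi]
  constructor
  · rintro ⟨h12, h34⟩
    refine ⟨fun x'' z hz => ?_, fun x'' y'' z hz hxy hpt => ?_⟩
    · obtain ⟨x', rfl⟩ := hsurj x''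
      exact h12 x' z hz
    · obtain ⟨x', rfl⟩ := hsurj x''
      obtain ⟨y', rfl⟩ := hsurj y''
      exact h34 x' y' z hz hxy hpt
  · rintro ⟨h12, h34⟩
    refine ⟨fun x' z hz => ?_, fun x' y' z hz hxy hpt => ?_⟩
    · exact h12 _ z hz
    · exact h34 _ _ z hz hxy hpt

/-- Hence `Prop38KingOrder` transfers. [cite: King1986, Prop. 3.8 (3.71) p.664] -/
theorem prop38KingOrder_kingTwoSpacingFull_iff :
    Prop38KingOrder (kingTwoSpacingFull L a msq j n) ↔ Prop38KingOrder (kingTwoSpacingH L a msq j n) := by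
  unfold Prop38KingOrder
  simp only [prop38PrintedAt_kingTwoSpacingFull_iff]

/-! ## §4 King's §3.3 at `A = 0`, by name, for ONE system of objects -/

variable (L)

/-- ★★ **(3.71) AT EACH HÖLDER EXPONENT FOR THE JOINT RECORD, CONSTANTS UNIFORM in the volume, the extra scales and the mass** (odd `L ≥ 3`, `a > 0`,
`m₀² ≥ 0`, `0 < α < 1`): ONE `(C, δ₀, γ > 0)` with `Prop38PrintedAt α (kingTwoSpacingFull L a m² j n) C δ₀ γ` for EVERY `j`, `n ≥ 1`, `0 < m² ≤ m₀²` —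
dag-n15-d part 54 `N15.KingModel.slicePropagator_prop38PrintedAt_kingTwoSpacingH_unif` BY NAME through §3. [cite: King1986, Prop. 3.8 (3.71) p.664, §4 pp.673–674] -/
theorem prop38PrintedAt_kingTwoSpacingFull_unif (hLodd : Odd L) (hL : 2 ≤ L) {a : ℝ} (ha : 0 < a) {m0sq : ℝ} (hm0 : 0 ≤ m0sq) {α : ℝ}
    (hα0 : 0 < α) (hα1 : α < 1) :
    ∃ C δ₀ γ : ℝ, 0 < C ∧ 0 < δ₀ ∧ 0 < γ ∧ ∀ (msq : ℝ) (_hm : 0 < msq) (_hcap : msq ≤ m0sq) (j : KingVolIndex d) (n : ℕ) (_hn : 1 ≤ n),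
      Prop38PrintedAt α (kingTwoSpacingFull L a msq j n) C δ₀ γ := by
  obtain ⟨C, δ₀, γ, hC, hδ₀, hγ, H⟩ := slicePropagator_prop38PrintedAt_kingTwoSpacingH_unif (d := d) L hLodd hL ha hm0 hα0 hα1
  exact ⟨C, δ₀, γ, hC, hδ₀, hγ, fun msq hm hcap j n hn => (prop38PrintedAt_kingTwoSpacingFull_iff a msq j n α C δ₀ γ).2 (H msq hm hcap j n hn)⟩

/-- ★★ **(3.73)–(3.75) AT EACH HÖLDER EXPONENT FOR THE JOINT RECORD, CONSTANTS UNIFORM in the volume, the scales and the mass** (odd `L ≥ 3`, `a > 0`,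
`m₀² ≥ 0`, `0 < α < 1`): ONE `(C, δ₀, γ > 0)` with `Prop39PrintedAt α (kingTwoSpacingFull L a m² j n) C δ₀ γ` for EVERY `j`, `n ≥ 1`, `0 < m² ≤ m₀²` — part Χ-d
`prop39PrintedAt_king_zeroField` BY NAME through §2. [cite: King1986, Prop. 3.9 (3.73)–(3.75) p.665, (4.42)–(4.43) p.675] -/
theorem prop39PrintedAt_kingTwoSpacingFull_unif (hLodd : Odd L) (hL : 2 ≤ L) {a : ℝ} (ha : 0 < a) {m0sq : ℝ} (hm0 : 0 ≤ m0sq) {α : ℝ}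
    (hα0 : 0 < α) (hα1 : α < 1) :
    ∃ C δ₀ γ : ℝ, 0 < C ∧ 0 < δ₀ ∧ 0 < γ ∧ ∀ (msq : ℝ) (_hm : 0 < msq) (_hcap : msq ≤ m0sq) (j : KingVolIndex d) (n : ℕ) (_hn : 1 ≤ n),
      Prop39PrintedAt α (kingTwoSpacingFull L a msq j n) C δ₀ γ := by
  obtain ⟨C, δ₀, γ, hC, hδ₀, hγ, H⟩ := prop39PrintedAt_king_zeroField (d := d) L hLodd hL ha hm0 hα0 hα1
  refine ⟨C, δ₀, γ, hC, hδ₀, hγ, fun msq hm hcap j n hn => ?_⟩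
  haveI := kingVol_neZero L j
  exact (prop39PrintedAt_kingTwoSpacingFull_iff a msq j n α C δ₀ γ).2 (H j.K n j.m j.one_le_K hn (kingVol L j) (fun _ => rfl) msq hm hcap)

/-- ★★ **KING's PROPOSITION 3.8 IN KING's QUANTIFIER ORDER FOR THE JOINT RECORD** — dag-n15-d part 54 `N15.KingModel.prop38KingOrder_kingTwoSpacingH` BY NAME.
[cite: King1986, Prop. 3.8 (3.71) p.664] -/
theorem prop38KingOrder_kingTwoSpacingFull (hLodd : Odd L) (hL : 2 ≤ L) {a msq : ℝ} (ha : 0 < a) (hm : 0 < msq) (j : KingVolIndex d) (n : ℕ)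
    (hn : 1 ≤ n) : Prop38KingOrder (kingTwoSpacingFull L a msq j n) :=
  (prop38KingOrder_kingTwoSpacingFull_iff a msq j n).2 (prop38KingOrder_kingTwoSpacingH (d := d) L hLodd hL ha hm j n hn)

/-- ★★ **KING's PROPOSITION 3.9 IN KING's QUANTIFIER ORDER FOR THE JOINT RECORD** — part Χ-d `prop39KingOrder_king_zeroField` BY NAME.
[cite: King1986, Prop. 3.9 (3.73)–(3.75) p.665] -/
theorem prop39KingOrder_kingTwoSpacingFull (hLodd : Odd L) (hL : 2 ≤ L) {a : ℝ} (ha : 0 < a) {m0sq : ℝ} (hm0 : 0 ≤ m0sq) (j : KingVolIndex d)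
    {n : ℕ} (hn : 1 ≤ n) {msq : ℝ} (hmsq : 0 < msq) (hcap : msq ≤ m0sq) : Prop39KingOrder (kingTwoSpacingFull L a msq j n) := by
  haveI := kingVol_neZero L j
  exact (prop39KingOrder_kingTwoSpacingFull_iff a msq j n).2
    (prop39KingOrder_king_zeroField (d := d) L hLodd hL ha hm0 j.one_le_K hn j.m (kingVol L j) (fun _ => rfl) hmsq hcap)

/-- ★ **PROPOSITION 3.7 FOR THE JOINT RECORD's COARSE SLICES** — part Ρ-g `prop37KingOrder_king_zeroField` BY NAME (the coarse datum IS part Ρ-e's).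
[cite: King1986, Prop. 3.7 (3.63)–(3.65) p.663] -/
theorem prop37KingOrder_kingTwoSpacingFull_lo (hLodd : Odd L) (hL : 2 ≤ L) {a : ℝ} (ha : 0 < a) {m0sq : ℝ} (hm0 : 0 ≤ m0sq) (j : KingVolIndex d)
    (n : ℕ) {msq : ℝ} (hmsq : 0 < msq) (hcap : msq ≤ m0sq) : Prop37KingOrder (kingTwoSpacingFull L a msq j n).lo := by
  haveI := kingVol_neZero L j
  exact prop37KingOrder_king_zeroField (d := d) L hLodd hL ha hm0 j.one_le_K j.m (kingVol L j) (fun _ => rfl) hmsq hcap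

/-- ★★★ **KING 1986 §3.3 AT `A = 0` — PROPOSITIONS 3.7, 3.8, 3.9 AND (2.17), BY NAME, FOR ONE SYSTEM OF OBJECTS.**  For odd `L ≥ 3`, `a > 0`, a volume∕scale
index `j` (Bałaban's volume `2L^{j.m}`, `K = j.K ≥ 1` coarse scales), `n ≥ 1` extra scales, a mass `0 < m² ≤ m₀²`, and the joint two-spacing record
`T = kingTwoSpacingFull L a m² j n` (EVERY field of the typer's `TwoSpacing` live except the contour sort, empty by type in the scalar model):
(i) `Prop37KingOrder T.lo` — Prop. 3.7 (3.63)∕(3.65) for the coarse run's slices `G^η_{(j)}`, `0 ≤ j ≤ K − 1`;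
(ii) `Prop37KingOrder` for the `(K+n)`-level run's slices (King's `−n ≤ j ≤ K − 1`);
(iii) `Prop38KingOrder T` — Prop. 3.8 (3.71), all four lines, for `ℋ_K`, `ℋ_{K+n}` = `a_kG^η_kQ^*_k`, `a_{k+n}G^{η′}_{k+n}Q^*_{k+n}` (dag-n15-d's theorem by name);
(iv) `Prop39KingOrder T` — Prop. 3.9 (3.73)∕(3.75) for the slices at the two spacings;
(v) `Σ_{j<K} G^η_{(j)}(x, y) = G^η_K(x, y)` and (vi) `Σ_{j<K} G^{η′}_{(j)}(x′, y′) + Σ_{i<n} G^{η′}_{(i−n)}(x′, y′) = G^{η′}_{K+n}(x′, y′)` EXACTLY ((2.17), part Χ-e), the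
propagators being King's∕Bałaban's `constrainedProp (L^K) M a_K (L^K)² m²` and `constrainedProp (L^{K+n}) M a_{K+n} (L^{K+n})² m²` ([Ba 4] (1.6) `G_k(T_ε, 0)`).
King's `A = 0` MODEL — NOT [Ba 4]∕[King1986] §4 at `A ≠ 0`, NOT Bałaban's `G(U)`, `H_k(U)`.
[cite: King1986, (2.17) p.653, Prop. 3.7 (3.63)–(3.65) p.663, Prop. 3.8 (3.71) p.664, Prop. 3.9 (3.73)–(3.75) p.665] -/
theorem king_props37_38_39_and_217_oneDatum (hLodd : Odd L) (hL : 2 ≤ L) {a : ℝ} (ha : 0 < a) {m0sq : ℝ} (hm0 : 0 ≤ m0sq)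
    (j : KingVolIndex d) {n : ℕ} (hn : 1 ≤ n) {msq : ℝ} (hmsq : 0 < msq) (hcap : msq ≤ m0sq) :
    haveI := kingVol_neZero L j; Prop37KingOrder (kingTwoSpacingFull L a msq j n).lo ∧
      Prop37KingOrder (kingSliceKernels L (j.K + n) j.m (kingVol L j) (fun _ => rfl) (one_le_add_of_one_le j.one_le_K n) a msq) ∧
      Prop38KingOrder (kingTwoSpacingFull L a msq j n) ∧
      Prop39KingOrder (kingTwoSpacingFull L a msq j n) ∧
      (∀ x y : Tor (fine (L ^ j.K) (kingVol L j)),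
        ∑ i ∈ Finset.range j.K, (kingTwoSpacingFull L a msq j n).lo.G i x y
          = constrainedProp (L ^ j.K) (kingVol L j) (aK a L j.K) (((L ^ j.K : ℕ) : ℝ) ^ 2) msq x y) ∧
      (∀ x' y' : Tor (fine (L ^ (j.K + n)) (kingVol L j)),
        ∑ i ∈ Finset.range j.K, (kingTwoSpacingFull L a msq j n).hi.G i x' y'
            + ∑ i ∈ Finset.range n,
                (kingSliceKernels L (j.K + n) j.m (kingVol L j) (fun _ => rfl) (one_le_add_of_one_le j.one_le_K n) a msq).G i x' y'
          = constrainedProp (L ^ (j.K + n)) (kingVol L j) (aK a L (j.K + n)) (((L ^ (j.K + n) : ℕ) : ℝ) ^ 2) msq x' y') := by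
  haveI := kingVol_neZero L j
  obtain ⟨h37lo, h37hi, _, h217lo, h217hi⟩ :=
    king_slices_props37_39_and_217_at_zeroField (d := d) L hLodd hL ha hm0 j.one_le_K hn j.m (kingVol L j) (fun _ => rfl) hmsq hcap
  exact ⟨h37lo, h37hi, prop38KingOrder_kingTwoSpacingFull L hLodd hL ha hmsq j n hn,
    prop39KingOrder_kingTwoSpacingFull L hLodd hL ha hm0 j hn hmsq hcap, h217lo, h217hi⟩

/-- The joint family is not void: for every `m₀² > 0` there are an index, a run length and a mass in range carrying Propositions 3.8 and 3.9 in King's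
order on ONE record (e.g. `j = ⟨0, 1, _, 1, _⟩`, `n = 1`, `m² = m₀²`). [folklore] -/
theorem kingTwoSpacingFull_family_nonempty (hLodd : Odd L) (hL : 2 ≤ L) {a : ℝ} (ha : 0 < a) {m0sq : ℝ} (hm0 : 0 < m0sq) :
    ∃ (j : KingVolIndex d) (n : ℕ) (msq : ℝ), 1 ≤ n ∧ 0 < msq ∧ msq ≤ m0sq ∧
      Prop38KingOrder (kingTwoSpacingFull L a msq j n) ∧ Prop39KingOrder (kingTwoSpacingFull L a msq j n) :=
  ⟨⟨0, 1, le_rfl, 1, le_rfl⟩, 1, m0sq, le_rfl, hm0, le_rfl,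
    prop38KingOrder_kingTwoSpacingFull L hLodd hL ha hm0 _ 1 le_rfl,
    prop39KingOrder_kingTwoSpacingFull L hLodd hL ha hm0.le _ le_rfl hm0 le_rfl⟩

/-! ## §5 The record's external-line kernels ARE King's `a_kG^η_kQ_k^*` built from the record's OWN slices ((2.15) with (2.17)) -/

section Dictionary215

variable {dd : ℕ}

/-- **`ℋ = a·G·Qᵀ`** in part J's matrix vocabulary: the minimiser matrix `(aN^d)·A₀⁻¹Qᵀ` is `a` times the block-constrained propagator `G = N^d·A₀⁻¹`
composed with the transposed block mean — King's definition `ℋ_k = a_kG^ε_kQ_k^*` of the minimiser kernel ((2.15)), as an identity of matrices.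
[cite: King1986, (2.13)–(2.15) p.653] -/
theorem minimiserMat_eq_smul_constrainedProp_mul_transpose (N : ℕ) [NeZero N] (M : Fin dd → ℕ) [∀ μ, NeZero (M μ)] (a c m2 : ℝ) :
    minimiserMat N M a c m2 = a • (constrainedProp N M a c m2 * (Qmat N M)ᵀ) := by
  rw [minimiserMat, constrainedProp, Matrix.smul_mul, smul_smul]

/-- The block mean does not see the spelling of the number of fine sites per block (`N = N′` propositionally, carriers identified by `torCongr`).
[cite: King1986, (2.4) p.652, (2.20) p.654] -/
theorem Qmat_transportN {N N' : ℕ} [NeZero N] [NeZero N'] (M : Fin dd → ℕ) [∀ μ, NeZero (M μ)] (hN : N = N')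
    (h : ∀ μ, fine N M μ = fine N' M μ) (b : Tor M) (z : Tor (fine N M)) : Qmat N' M b (torCongr h z) = Qmat N M b z := by
  subst hN
  rw [torCongr_refl]

end Dictionary215

omit [NeZero L] in
/-- **`ℋ_K(x, B) = a_K·Σ_y G^η_K(x, y)·Q_K(B, y)`** — the cell's minimiser kernel `kingH` (g2, part C) IS King's `a_kG^η_kQ_k^*` with `G^η_K` = the
block-constrained propagator `constrainedProp (L^K) M a_K (L^K)² m²` ([Ba 4] (1.6) `G_k(T_ε, 0)` in level-`K` units) and `Q_K` the block mean (`Qmat`: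
`Q(B, y) = (L^K)^{−(d+1)}·[y ∈ B]`). [cite: King1986, (2.13)–(2.15) p.653] -/
theorem kingH_eq_aK_sum_constrainedProp (N : ℕ) [NeZero N] (M : Fin (d + 1) → ℕ) [∀ μ, NeZero (M μ)] (a m2 : ℝ) (K : ℕ) (b : Tor M)
    (x : Tor (fine N M)) :
    kingH L N M a m2 K b x = aK a L K * ∑ y, constrainedProp N M (aK a L K) (((N : ℕ) : ℝ) ^ 2) m2 x y * Qmat N M b y := by
  rw [kingH, ← minimiserMat_apply, minimiserMat_eq_smul_constrainedProp_mul_transpose, Matrix.smul_apply, Matrix.mul_apply, smul_eq_mul]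
  rfl

/-- ★★ **THE RECORD's COARSE EXTERNAL-LINE KERNEL IS `a_KG^η_KQ_K^*` OF THE RECORD's OWN SLICES**: for `T = kingTwoSpacingFull L a m² j n`,
`T.K x z = a_K · Σ_y (Σ_{i<K} T.lo.G i x y) · Q_K(B(z), y)` — King's (2.15) `ℋ_k = a_kG^η_kQ_k^*` with `G^η_k = Σ_j G^η_{(j)}` ((2.17), part Χ-e) — so Proposition 3.8's
object and Proposition 3.9's objects on this record are ONE system: the former is a function of the latter, exactly. (`L ≥ 2`, `a, m² > 0` for (2.17).)
[cite: King1986, (2.15) p.653, (2.17) p.653, p.664 («a_kG^η_kQ^*_k(x, z)»)] -/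
theorem kingTwoSpacingFull_K_eq_aK_sum_slices (hL : 2 ≤ L) {a : ℝ} (ha : 0 < a) {msq : ℝ} (hmsq : 0 < msq) (j : KingVolIndex d) (n : ℕ)
    (x z : Tor (fine (L ^ j.K) (kingVol L j))) :
    haveI := kingVol_neZero L j; (kingTwoSpacingFull L a msq j n).K x z
      = aK a L j.K * ∑ y : Tor (fine (L ^ j.K) (kingVol L j)), (∑ i ∈ Finset.range j.K, (kingTwoSpacingFull L a msq j n).lo.G i x y)
          * Qmat (L ^ j.K) (kingVol L j) (blockOf (L ^ j.K) (kingVol L j) z) y := by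
  haveI := kingVol_neZero L j
  rw [kingTwoSpacingFull_K, kingH_eq_aK_sum_constrainedProp]
  congr 1
  refine Finset.sum_congr rfl fun y _ => ?_
  rw [← sum_kingSliceG_eq_constrainedProp L hL ha j.K j.one_le_K j.m (kingVol L j) (fun _ => rfl) hmsq x y]
  rfl

/-- ★★ **THE RECORD's FINE EXTERNAL-LINE KERNEL IS `a_{K+n}G^{η′}_{K+n}Q_{K+n}^*`**, read on the record's fine carrier: for `T = kingTwoSpacingFull L a m² j n`,
`T.K′ x′ z = a_{K+n} · Σ_{y′} G^{η′}_{K+n}(x′, y′) · Q_{K+n}(B(z), y′)` with `G^{η′}_{K+n} = constrainedProp (L^{K+n}) M a_{K+n} (L^{K+n})² m²` — the `(K+n)`-run's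
(2.15), the carrier re-spelling `L^{K+n} = L^nL^K` discharged by part Χ-e's `constrainedProp_transport`. [cite: King1986, (2.15) p.653, (2.20) p.654, p.664] -/
theorem kingTwoSpacingFull_K'_eq_aK_sum_constrainedProp {a : ℝ} (msq : ℝ) (j : KingVolIndex d) (n : ℕ)
    (x' : Tor (fine (L ^ (j.K + n)) (kingVol L j))) (z : Tor (fine (L ^ j.K) (kingVol L j))) :
    haveI := kingVol_neZero L j; (kingTwoSpacingFull L a msq j n).K' x' z
      = aK a L (j.K + n) * ∑ y', constrainedProp (L ^ (j.K + n)) (kingVol L j) (aK a L (j.K + n)) (((L ^ (j.K + n) : ℕ) : ℝ) ^ 2) msq x' y'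
          * Qmat (L ^ (j.K + n)) (kingVol L j) (blockOf (L ^ j.K) (kingVol L j) z) y' := by
  haveI := kingVol_neZero L j
  have hN : L ^ (j.K + n) = L ^ n * L ^ j.K := by rw [pow_add, mul_comm]
  have hc : (((L ^ n * L ^ j.K : ℕ) : ℝ) ^ 2) = (((L ^ (j.K + n) : ℕ) : ℝ) ^ 2) := by rw [hN]
  rw [kingTwoSpacingFull_K', kingH_eq_aK_sum_constrainedProp, hc,
    ← Equiv.sum_comp (torCongr (carrier_pow_add L j.K n (kingVol L j)))]
  congr 1
  refine Finset.sum_congr rfl fun y' _ => ?_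
  rw [constrainedProp_transport hN (fun _ => rfl) (carrier_pow_add L j.K n (kingVol L j)),
    Qmat_transportN (kingVol L j) hN (carrier_pow_add L j.K n (kingVol L j))]

/-- ★★ … **OF THE RECORD's OWN FINE SLICES**: `T.K′ x′ z = a_{K+n} · Σ_{y′} (Σ_{i<K} T.hi.G i x′ y′ + Σ_{i<n} G^{η′}_{(i−n)}(x′, y′)) · Q_{K+n}(B(z), y′)` — (2.15) with the
`(K+n)`-run's (2.17) (part Χ-e `sum_hiG_add_finest_eq`: the record's fine slices `j = 0, …, K − 1` plus the `n` finest slices of King's indexing `−n ≤ j < 0`).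
[cite: King1986, (2.15) p.653, (2.17) p.653, Prop. 3.7 p.663 («−n ≤ j ≤ k − 1»), p.664] -/
theorem kingTwoSpacingFull_K'_eq_aK_sum_slices (hL : 2 ≤ L) {a : ℝ} (ha : 0 < a) {msq : ℝ} (hmsq : 0 < msq) (j : KingVolIndex d) (n : ℕ)
    (x' : Tor (fine (L ^ (j.K + n)) (kingVol L j))) (z : Tor (fine (L ^ j.K) (kingVol L j))) :
    haveI := kingVol_neZero L j; (kingTwoSpacingFull L a msq j n).K' x' z
      = aK a L (j.K + n) * ∑ y' : Tor (fine (L ^ (j.K + n)) (kingVol L j)), (∑ i ∈ Finset.range j.K, (kingTwoSpacingFull L a msq j n).hi.G i x' y'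
            + ∑ i ∈ Finset.range n,
                (kingSliceKernels L (j.K + n) j.m (kingVol L j) (fun _ => rfl) (one_le_add_of_one_le j.one_le_K n) a msq).G i x' y')
          * Qmat (L ^ (j.K + n)) (kingVol L j) (blockOf (L ^ j.K) (kingVol L j) z) y' := by
  haveI := kingVol_neZero L j
  rw [kingTwoSpacingFull_K'_eq_aK_sum_constrainedProp]
  congr 1
  refine Finset.sum_congr rfl fun y' _ => ?_
  rw [← sum_hiG_add_finest_eq L hL ha j.one_le_K (kingVol L j) (fun _ => rfl) hmsq x' y']
  rfl

end Summit.QuantumFields.YangMills.BalabanUVNodes.N15KingModelRung.Curved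

end
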